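/-
Copyright (c) 2026 the pub-hodgecm-mathlib formalisation cell (harness21).  Prover seat hodgecm-mathlib-K2Liu-p14 (g3), Track B «K2-LIT»,
#184♮ = hLiu418 = `stmt-HodgeConjecture-24832`; Road I v3, S5-F3 lineage ∕ I4-conv (F′-fact), E-FINAL OF RECORD: the factorizable line family at the bridge of record.
-/
import Summits.HodgeConjecture.HodgeConjecture.Theorems.K2LiuKlingenInnerSectionFactorizableLine   -- ★ E-final: `exists_factorizable_line` (bridge `Ψ_S` by value)
import Summits.HodgeConjecture.HodgeConjecture.Theorems.K2LiuKlingenBridgePlaceReading              -- ★ BR: the place readings of `Ψ_S = adelicUnitaryGroupCongr L S J₁^𝔻 J hc`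
import HarnessLib

/-!
# Crux `HLiu418`, I4-conv (F′-fact), E-FINAL OF RECORD — `K2LiuKlingenInnerSectionFactorizableLineOfRecord`:
# `∃ g gT′, IsFactorizableOff¹ T′ χ g gT′ ∧ F′_{h,f_s}(g₂) = g (s − ½) (Ψ_S g₂)` AT THE BRIDGE OF RECORD `Ψ_S = (g₂ ↦ S_𝔸 g₂ S_𝔸⁻¹)`

Cell `hodgecm-mathlib`, crux item hLiu418 = `stmt-HodgeConjecture-24832`; squad K2 ∕ K2Liu; LEAD F0P6-plan (g14) BATCH #36∕#56 (I4-conv organ, U1 E-lineage =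
K2Liu-p14 (g3)).  THEOREMS ONLY (no `def`, no instance, no notation, no named-fact hypothesis, no `sorry`); lane `--supports stmt-HodgeConjecture-24832 --as helper`
(count-neutral).

THE POINT.  ★ E-final `K2LiuKlingenInnerSectionFactorizableLine.exists_factorizable_line` proves that the inner-section family of term 2 of the Klingen constant term,
`F′_{h,f_s}(g₂) = ∫_{Y(𝔸)×𝔸_L} f_s(Ψ(ξ)Ψ(n_Q(y,0,t))Ψ(m_Q(1,j₂⁻¹g₂))h) d(μ_Y ⊗ μ_T)` (`g₂ ∈ U(J₂)(𝔸_{L⁺})`), is the value at `s − ½` of a ★ #31s-FACTORIZABLE line family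
`g` at `Ψ_S g₂`, for a line bridge `Ψ_S : U(J₂)(𝔸) ≃ₜ* H₁(𝔸)` taken BY VALUE together with its three place readings `hbr` (`(Ψ_S g₂)_v = Ψ_{S,v}((g₂)_v)`), `hbrT`, `hbrA`.
Here the bridge is THE BRIDGE OF RECORD of ★ carrier (A) `K2LiuKlingenTermTwoTransport` §3∕§4 — `Ψ_S := adelicUnitaryGroupCongr L S J₁^𝔻 ((StdForm.antidiagonal 2).over L) hc`,
`g₂ ↦ S_𝔸 g₂ S_𝔸⁻¹`, `S = (1 ½; 1 −½)`, `hc : ᵗ(cS)·J₁^𝔻·S = J₂` (★ `bridge_congr_over L S hS`) — and the three readings are DISCHARGED by ★ BR `K2LiuKlingenBridgePlaceReading`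
(`evalPlace_finPart_congr`, `evalPlace_finPart_congr_symm_eq_of_eq`, `archPart_congr_symm_eq_of_eq`; `Ψ_{S,v} =` ★ «D5» `localCongr L c S one_ne_zero _ v`).  So the
section `x ↦ F′_{h,f_s}(Ψ_S⁻¹ x)` of `I_Δ,line(s − ½, χ)` whose Siegel Eisenstein series IS term 2 (★ (A) `eisensteinSeriesU_eq_eisensteinSeriesDelta` ∕ §4) coincides on the
convergence region with `g (s − ½)`, `g` ★ `IsFactorizableOff` off `T′` — the input of Road Φ's ★ Φ3d `whittakerDelta_eq_mul_tprod_euler` at `n := 1` (I4 proper).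
REMAINING BINDERS (all by name elsewhere or structural): the F-files' transport pins `hΨ ha hSA hSAi` (★ (A) §4 VERBATIM) with `SA` integral off `T′` (`hSint`), `χ` unramified
off `T′`, `|2| = 1` off `T′` (`h2`, `h2w`), `δ` a unit off `T′`, the local Haar normalisations `hν1`, `f` ★ #31s-factorizable off `T′` (`hfac`), `h` integral off `T′` (`hh`),
the bridge matrix `S` (`hS hS' hc`), and per `(s, g₂)` the integrability of the term-2 integrand.
* §1 **`exists_factorizable_line_ofRecord`** — THE HEAD.
[CasselsFrohlichANT1967, Ch. XV (Tate) §3.3 Thm. 3.3.1], [MoeglinWaldspurger1995, II.1.7], [Liu2011, §2B p. 862, §2C (2-4)], [Tan1999, §1–§2], [PlatonovRapinchuk1994, §2.3, §5.1].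
HONEST LABEL.  Count-neutral helper, closes no socket: `HC_CM` is proved only modulo the 7 printed citations (2 remaining named inputs: hLiu418 =
`stmt-HodgeConjecture-24832`, h413 = `stmt-HodgeConjecture-24833`) until rung 0 closes.
-/

set_option autoImplicit false
set_option linter.dupNamespace false -- the mandated namespace repeats `HodgeConjecture.HodgeConjecture`

noncomputable section

open scoped Matrix ENNReal NNReal Topology
open NumberField IsDedekindDomain MeasureTheory Measure Filter Set

namespace Summit.HodgeConjecture.HodgeConjecture.Cruxes.HLiu418.K2LiuKlingenInnerSectionFactorizableLineOfRecord

open Literature.NumberTheory.Automorphic Literature.NumberTheory.Automorphic.UnitaryGroup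
open Literature.NumberTheory.GelbartRogawski1991 Literature.NumberTheory.GelbartRogawski1991.GRConstruction
open Literature.NumberTheory.GaloisRepresentations
open Literature.NumberTheory.K2Lit.SiegelDoubled Literature.NumberTheory.K2Lit.LocalSiegelDoubled
open Summit.HodgeConjecture.HodgeConjecture.Cruxes.HLiu418.K2LiuKlingenParabolicDefs
open Summit.HodgeConjecture.HodgeConjecture.Cruxes.HLiu418.K2LiuKlingenUnipotentAdelicDefs
open Summit.HodgeConjecture.HodgeConjecture.Cruxes.HLiu418.K2LiuSiegelDoubledLeviMatrix (conjAdele_conjAdele')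
open Summit.HodgeConjecture.HodgeConjecture.Cruxes.HLiu418.K2LiuKlingenInnerSectionLocalDefs
open Summit.HodgeConjecture.HodgeConjecture.Cruxes.HLiu418.K2LiuKlingenInnerSectionFactorizableLine (exists_factorizable_line)
open Summit.HodgeConjecture.HodgeConjecture.Cruxes.HLiu418.K2LiuKlingenBridgePlaceReading
open Summit.HodgeConjecture.HodgeConjecture.Cruxes.HLiu418.K2LiuLineBridgeLocalDictionary (formCongr_bridge)

variable (L : Type) [Field L] [NumberField L] [IsCMField L]

/-! ## §1 THE HEAD at the bridge of record -/

section Head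

variable {N M : ℕ} {e : Fin N × Fin M ≃ Fin 2}
  {dV : Fin N → L} {hdV : ∀ i, IsCMField.complexConj L (dV i) = dV i}
  {dW : Fin M → L} {hdW : ∀ i, IsCMField.complexConj L (dW i) = dW i}

/-- **THE INNER-SECTION FAMILY OF TERM 2 IS A FACTORIZABLE LINE FAMILY, AT THE BRIDGE OF RECORD `Ψ_S = adelicUnitaryGroupCongr L S J₁^𝔻 J₂ hc`** (statement in the
header): ★ E-final `exists_factorizable_line` with its three bridge readings `hbr`, `hbrT`, `hbrA` discharged by ★ BR (`evalPlace_finPart_congr` at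
`h₁ := (formCongr_bridge L S hS).trans (antidiagOne_eq_over L 2)`, `evalPlace_finPart_congr_symm_eq_of_eq`, `archPart_congr_symm_eq_of_eq`).
[cite: CasselsFrohlichANT1967, Ch. XV (Tate) §3.3 Thm. 3.3.1] [cite: MoeglinWaldspurger1995, II.1.7] [cite: Liu2011, §2B p. 862] [cite: Tan1999, §1] [cite: PlatonovRapinchuk1994, §2.3, §5.1] -/
theorem exists_factorizable_line_ofRecord
    [MeasurableSpace (AdeleRing (𝓞 L) L)] [BorelSpace (AdeleRing (𝓞 L) L)]
    [MeasurableSpace (InfiniteAdeleRing (Fp L))] [BorelSpace (InfiniteAdeleRing (Fp L))]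
    [∀ v : HeightOneSpectrum (𝓞 (Fp L)), MeasurableSpace (v.adicCompletion (Fp L))] [∀ v : HeightOneSpectrum (𝓞 (Fp L)), BorelSpace (v.adicCompletion (Fp L))]
    [∀ v : HeightOneSpectrum (𝓞 (Fp L)), MeasurableSpace (LocalRing L v)] [∀ v : HeightOneSpectrum (𝓞 (Fp L)), BorelSpace (LocalRing L v)]
    {δ : L} (hσδ : IsCMField.complexConj L δ = -δ) (hδ : δ ≠ 0)
    (Y : AddSubgroup (AdeleRing (𝓞 L) L)) (hY : ∀ y, y ∈ Y ↔ conjAdele (Fp L) L (IsCMField.complexConj L) y = -y)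
    (μY : Measure ↥Y) (μT : Measure (AdeleRing (𝓞 L) L)) [μY.IsAddHaarMeasure] [μT.IsAddHaarMeasure]
    (T' : Finset (HeightOneSpectrum (𝓞 (Fp L))))
    (νY : ∀ v : HeightOneSpectrum (𝓞 (Fp L)), Measure ↥(skewLoc L v)) (νT : ∀ v : HeightOneSpectrum (𝓞 (Fp L)), Measure (LocalRing L v))
    [∀ v, SFinite (νY v)] [∀ v, (νY v).IsAddLeftInvariant] [∀ v, SFinite (νT v)] [∀ v, (νT v).IsAddHaarMeasure]
    [∀ v, ((νY v).prod (νT v)).IsAddHaarMeasure]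
    (h2 : ∀ v, v ∉ T' → Valued.v ((2 : Fp L) : v.adicCompletion (Fp L)) = 1)
    (h2w : ∀ v, v ∉ T' → ∀ w : PlacesOver L v, ValuativeRel.valuation (w.1.adicCompletion L) (2 : w.1.adicCompletion L) = 1)
    (hδv : ∀ v, v ∉ T' → ∀ w : PlacesOver L v, Valued.v (algebraMap L (w.1.adicCompletion L) δ) = 1)
    (hν1 : ∀ v, v ∉ T' → ((νY v).prod (νT v))
      {q : ↥(skewLoc L v) × LocalRing L v | (∀ w : PlacesOver L v, (q.1 : LocalRing L v) w ∈ w.1.adicCompletionIntegers L) ∧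
        ∀ w : PlacesOver L v, q.2 w ∈ w.1.adicCompletionIntegers L} = 1)
    -- the F-files' transport, pinned (★ carrier (A) `K2LiuKlingenTermTwoTransport` §4 binders verbatim)
    {SA : GL (Fin (2 + 2)) (AdeleRing (𝓞 L) L)} (Ψ : (quasiSplit (Fp L) L (IsCMField.complexConj L) (2 + 2)).Adelic ≃ₜ* HA L e dV hdV dW hdW)
    {X Y' : Matrix (Fin 2) (Fin 2) (Fp L)} {a : Fp L}
    (hΨ : ∀ g : (quasiSplit (Fp L) L (IsCMField.complexConj L) (2 + 2)).Adelic,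
      (((Ψ g : HA L e dV hdV dW hdW) : GL (Fin (2 + 2)) (AdeleRing (𝓞 L) L)) : Matrix (Fin (2 + 2)) (Fin (2 + 2)) (AdeleRing (𝓞 L) L)) =
        (SA : Matrix (Fin (2 + 2)) (Fin (2 + 2)) (AdeleRing (𝓞 L) L)) *
          ((adelicVal (Fp L) L (IsCMField.complexConj L) (2 + 2) _ g : GL (Fin (2 + 2)) (AdeleRing (𝓞 L) L)) :
            Matrix (Fin (2 + 2)) (Fin (2 + 2)) (AdeleRing (𝓞 L) L)) *
          ((SA⁻¹ : GL (Fin (2 + 2)) (AdeleRing (𝓞 L) L)) : Matrix (Fin (2 + 2)) (Fin (2 + 2)) (AdeleRing (𝓞 L) L)))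
    (ha : a + a = 1)
    (hSA : Matrix.reindex (e₂ (n := 2)).symm (e₂ (n := 2)).symm (SA : Matrix (Fin (2 + 2)) (Fin (2 + 2)) (AdeleRing (𝓞 L) L)) =
      Matrix.fromBlocks (1 : Matrix (Fin 2) (Fin 2) (AdeleRing (𝓞 L) L)) (X.map ((algebraMap L (AdeleRing (𝓞 L) L)).comp (algebraMap (Fp L) L))) 1
        (-(X.map ((algebraMap L (AdeleRing (𝓞 L) L)).comp (algebraMap (Fp L) L)))))
    (hSAi : Matrix.reindex (e₂ (n := 2)).symm (e₂ (n := 2)).symm ((SA⁻¹ : GL (Fin (2 + 2)) (AdeleRing (𝓞 L) L)) : Matrix (Fin (2 + 2)) (Fin (2 + 2)) (AdeleRing (𝓞 L) L)) =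
      Matrix.fromBlocks ((a • (1 : Matrix (Fin 2) (Fin 2) (Fp L))).map ((algebraMap L (AdeleRing (𝓞 L) L)).comp (algebraMap (Fp L) L)))
        ((a • (1 : Matrix (Fin 2) (Fin 2) (Fp L))).map ((algebraMap L (AdeleRing (𝓞 L) L)).comp (algebraMap (Fp L) L)))
        (Y'.map ((algebraMap L (AdeleRing (𝓞 L) L)).comp (algebraMap (Fp L) L)))
        (-(Y'.map ((algebraMap L (AdeleRing (𝓞 L) L)).comp (algebraMap (Fp L) L)))))
    (hSint : ∀ v, v ∉ T' → ∀ w : PlacesOver L v, GLn.evalAt (2 + 2) L w.1 (GLn.sndHom (2 + 2) L SA) ∈ glInt (2 + 2) (w.1.adicCompletion L))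
    (χ : HeckeCharacter L) (hχ : ∀ v, v ∉ T' → ∀ w : PlacesOver L v, χ.IsUnramifiedAt w.1)
    (f : ℂ → HA L e dV hdV dW hdW → ℂ)
    (fT : ℂ → arch (Fp L) L (IsCMField.complexConj L) (2 + 2) (hermD L e dV hdV dW hdW) ×
      (Π v : T', localPi L (IsCMField.complexConj L) (2 + 2) (hermD L e dV hdV dW hdW) v.1) → ℂ)
    (hfac : IsFactorizableOff L e dV hdV dW hdW T' χ f fT) (h : HA L e dV hdV dW hdW)
    (hh : ∀ v, v ∉ T' → evalPlace (Fp L) L (IsCMField.complexConj L) (2 + 2) (hermD L e dV hdV dW hdW) v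
      (finPart (Fp L) L (IsCMField.complexConj L) (2 + 2) (hermD L e dV hdV dW hdW) h) ∈ localInt L (IsCMField.complexConj L) (2 + 2) (hermD L e dV hdV dW hdW) v)
    -- the line bridge OF RECORD `Ψ_S := adelicUnitaryGroupCongr L S J₁^𝔻 J₂ hc` (★ carrier (A) §3; `hc` = ★ `bridge_congr_over L S hS`)
    (S : GL (Fin 2) L) (hS : (S : Matrix (Fin 2) (Fin 2) L) = !![1, 2⁻¹; 1, -2⁻¹]) (hS' : ((S⁻¹ : GL (Fin 2) L) : Matrix (Fin 2) (Fin 2) L) = !![2⁻¹, 2⁻¹; 1, -1])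
    (hc : ((S : Matrix (Fin 2) (Fin 2) L).map (cmConjRingHom L))ᵀ *
        hermD L (Equiv.prodUnique (Fin 1) (Fin 1)) (fun _ => (1 : L)) (fun _ => map_one _) (fun _ => (1 : L)) (fun _ => map_one _) * (S : Matrix (Fin 2) (Fin 2) L) =
      (StdForm.antidiagonal 2).over L) :
    haveI : Algebra.IsQuadraticExtension (Fp L) L := IsCMField.isQuadraticExtension L
    ∃ (g : ℂ → HA L (Equiv.prodUnique (Fin 1) (Fin 1)) (fun _ => (1 : L)) (fun _ => map_one _) (fun _ => (1 : L)) (fun _ => map_one _) → ℂ)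
      (gT' : ℂ → arch (Fp L) L (IsCMField.complexConj L) (1 + 1)
          (hermD L (Equiv.prodUnique (Fin 1) (Fin 1)) (fun _ => (1 : L)) (fun _ => map_one _) (fun _ => (1 : L)) (fun _ => map_one _)) ×
        (Π v : T', localPi L (IsCMField.complexConj L) (1 + 1)
          (hermD L (Equiv.prodUnique (Fin 1) (Fin 1)) (fun _ => (1 : L)) (fun _ => map_one _) (fun _ => (1 : L)) (fun _ => map_one _)) v.1) → ℂ),
      IsFactorizableOff L (Equiv.prodUnique (Fin 1) (Fin 1)) (fun _ => (1 : L)) (fun _ => map_one _) (fun _ => (1 : L)) (fun _ => map_one _) T' χ g gT' ∧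
      ∀ (s : ℂ) (g₂ : (quasiSplit (Fp L) L (IsCMField.complexConj L) 2).Adelic),
        Integrable (fun q : ↥Y × AdeleRing (𝓞 L) L =>
          f s (Ψ (jAdelic L 4 (weylXi (AdeleRing (𝓞 L) L) (conjAdele (Fp L) L (IsCMField.complexConj L)))) *
            Ψ (jAdelic L 4 (nKlingen (AdeleRing (𝓞 L) L) (conjAdele (Fp L) L (IsCMField.complexConj L)) (conjAdele_conjAdele' L)
              (((q.1 : ↥Y) : AdeleRing (𝓞 L) L)) ((hY _).1 q.1.2) 0 q.2)) *
            (Ψ (jAdelic L 4 (klingenLevi (AdeleRing (𝓞 L) L) (conjAdele (Fp L) L (IsCMField.complexConj L)) (conjAdele_conjAdele' L) 1 ((jAdelic L 2).symm g₂))) * h))) (μY.prod μT) →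
        ∫ q : ↥Y × AdeleRing (𝓞 L) L,
            f s (Ψ (jAdelic L 4 (weylXi (AdeleRing (𝓞 L) L) (conjAdele (Fp L) L (IsCMField.complexConj L)))) *
              Ψ (jAdelic L 4 (nKlingen (AdeleRing (𝓞 L) L) (conjAdele (Fp L) L (IsCMField.complexConj L)) (conjAdele_conjAdele' L)
                (((q.1 : ↥Y) : AdeleRing (𝓞 L) L)) ((hY _).1 q.1.2) 0 q.2)) *
              (Ψ (jAdelic L 4 (klingenLevi (AdeleRing (𝓞 L) L) (conjAdele (Fp L) L (IsCMField.complexConj L)) (conjAdele_conjAdele' L) 1 ((jAdelic L 2).symm g₂))) * h)) ∂(μY.prod μT) =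
          g (s - 1 / 2) (adelicUnitaryGroupCongr L S _ _ hc g₂) :=
  exists_factorizable_line L hσδ hδ Y hY μY μT T' νY νT h2 h2w hδv hν1 Ψ hΨ ha hSA hSAi hSint χ hχ f fT hfac h hh S hS hS'
    (adelicUnitaryGroupCongr L S _ _ hc)
    (fun v g₂ _ => evalPlace_finPart_congr L S hc ((formCongr_bridge L S hS).trans (antidiagOne_eq_over L 2)) v g₂)
    (fun v x x' hxx' => evalPlace_finPart_congr_symm_eq_of_eq L S hc v x x' hxx')
    (fun x x' hxx' => archPart_congr_symm_eq_of_eq L S hc x x' hxx')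

end Head

end Summit.HodgeConjecture.HodgeConjecture.Cruxes.HLiu418.K2LiuKlingenInnerSectionFactorizableLineOfRecord

end
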